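import Summits.AtomisticToContinuum.HydrodynamicLimit.Theorems.JParityClosureCollisionTightnessSweptTube
import Mathlib.Analysis.SpecialFunctions.Trigonometric.InverseDeriv
import HarnessLib

/-!
# `UGibbsSRBRigidity.TemperedCollisions` (stmt-AtomisticToContinuum-9391), step 1a:
# the arcsine and disc integrals

Helper file (`--supports stmt-AtomisticToContinuum-9391`) for the support item `TemperedCollisions` of the route
`UGibbsSRBRigidity` (N-uniform bound on `E[Σ_collisions ε_N/|⟨x_i − x_j, v_i − v_j⟩|]`).  The mark `1/|⟨ν, u⟩|` of a
collision, read on the swept tube of the one-window argument, is the weight `ε/(‖u‖ √(ε² − ‖p‖²))` (`p` the offset of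
the relative position across the relative velocity `u`); its integral over the tube reduces to the two elementary
integrals proved here:

* `integral_inv_sqrt_sq_sub_sq` — `∫_{-b}^{b} dy/√(b² − y²) = π` for `b > 0` (FTC for `arcsin (y/b)`; the integrand is
  the nonnegative derivative of a function continuous on `[-b, b]`, hence integrable,
  `intervalIntegral.integrableOn_deriv_of_nonneg`), and its `lintegral` form `lintegral_Icc_inv_sqrt_le` (`b ≥ 0`);
* `lintegral_disc_inv_sqrt_le` — `∫_{y₀² + y₁² ≤ ε²} dy/√(ε² − y₀² − y₁²) ≤ 2πε` (Fubini over the sections, each an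
  arcsine integral).

References: C. Cercignani, R. Illner, M. Pulvirenti, *The Mathematical Theory of Dilute Gases* (1994), App. 4.A.
-/

noncomputable section

open MeasureTheory Set Filter Topology
open scoped ENNReal InnerProductSpace

namespace Summit.AtomisticToContinuum.HydrodynamicLimit.Theorems

open Literature.Analysis.FluidPDE Literature.MathematicalPhysics.KineticTheory

/-! ### The arcsine integral `∫_{-b}^{b} dy / √(b² − y²) = π` -/

/-- The derivative of `y ↦ arcsin (y / b)` on `(-b, b)` is `1 / √(b² − y²)` (`b > 0`). [folklore] -/
theorem hasDerivAt_arcsin_div {b y : ℝ} (hb : 0 < b) (hy : y ∈ Ioo (-b) b) :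
    HasDerivAt (fun y : ℝ => Real.arcsin (y / b)) (1 / Real.sqrt (b ^ 2 - y ^ 2)) y := by
  have h1 : y / b ≠ -1 := by
    intro h
    have : y = -b := by field_simp at h; linarith
    linarith [hy.1]
  have h2 : y / b ≠ 1 := by
    intro h
    have : y = b := by field_simp at h; linarith
    linarith [hy.2]
  have hin : HasDerivAt (fun x : ℝ => x / b) (1 / b) y := (hasDerivAt_id y).div_const b
  have hd : HasDerivAt (Real.arcsin ∘ fun x : ℝ => x / b)
      (1 / Real.sqrt (1 - (y / b) ^ 2) * (1 / b)) y :=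
    (Real.hasDerivAt_arcsin h1 h2).comp y hin
  have hsq : Real.sqrt (1 - (y / b) ^ 2) = Real.sqrt (b ^ 2 - y ^ 2) / b := by
    have : 1 - (y / b) ^ 2 = (b ^ 2 - y ^ 2) / b ^ 2 := by
      field_simp
    rw [this, Real.sqrt_div' _ (sq_nonneg b), Real.sqrt_sq hb.le]
  have heq : 1 / Real.sqrt (1 - (y / b) ^ 2) * (1 / b) = 1 / Real.sqrt (b ^ 2 - y ^ 2) := by
    rw [hsq]
    have hpos : 0 < Real.sqrt (b ^ 2 - y ^ 2) := by
      apply Real.sqrt_pos.2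
      have hy2 : y ^ 2 < b ^ 2 := by
        apply sq_lt_sq' <;> linarith [hy.1, hy.2]
      linarith
    field_simp
  have hd' := hd.congr_deriv heq
  simpa only [Function.comp_def] using hd'

/-- **The arcsine integral**: `∫_{-b}^{b} dy / √(b² − y²) = π` for `b > 0` (FTC for `arcsin (y/b)`; the
integrand is the nonnegative derivative of a function continuous on `[-b, b]`, hence integrable). [folklore] -/
theorem integral_inv_sqrt_sq_sub_sq {b : ℝ} (hb : 0 < b) :
    ∫ y in (-b)..b, 1 / Real.sqrt (b ^ 2 - y ^ 2) = Real.pi := by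
  have hcont : ContinuousOn (fun y : ℝ => Real.arcsin (y / b)) (Icc (-b) b) :=
    (Real.continuous_arcsin.comp (continuous_id.div_const b)).continuousOn
  have hderiv : ∀ y ∈ Ioo (-b) b,
      HasDerivAt (fun y : ℝ => Real.arcsin (y / b)) (1 / Real.sqrt (b ^ 2 - y ^ 2)) y :=
    fun y hy => hasDerivAt_arcsin_div hb hy
  have hint : IntervalIntegrable (fun y : ℝ => 1 / Real.sqrt (b ^ 2 - y ^ 2)) volume (-b) b := by
    refine intervalIntegral.intervalIntegrable_deriv_of_nonneg (g := fun y : ℝ => Real.arcsin (y / b)) ?_ ?_ ?_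
    · rwa [uIcc_of_le (by linarith)]
    · rw [min_eq_left (by linarith), max_eq_right (by linarith)]
      exact hderiv
    · intro y _
      positivity
  rw [intervalIntegral.integral_eq_sub_of_hasDerivAt_of_le (by linarith) hcont hderiv hint]
  rw [div_self hb.ne', neg_div, div_self hb.ne', Real.arcsin_one, Real.arcsin_neg_one]
  ring

/-- `lintegral` form on a symmetric closed interval: `∫⁻_{[-b, b]} ofReal (1/√(b² − y²)) ≤ ofReal π` for
every `b ≥ 0` (for `b = 0` the interval is a point). [folklore] -/
theorem lintegral_Icc_inv_sqrt_le {b : ℝ} (hb : 0 ≤ b) :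
    ∫⁻ y in Icc (-b) b, ENNReal.ofReal (1 / Real.sqrt (b ^ 2 - y ^ 2)) ≤ ENNReal.ofReal Real.pi := by
  rcases hb.eq_or_lt with rfl | hb0
  · simp
  have hint : IntegrableOn (fun y : ℝ => 1 / Real.sqrt (b ^ 2 - y ^ 2)) (Ioc (-b) b) := by
    refine intervalIntegral.integrableOn_deriv_of_nonneg (g := fun y : ℝ => Real.arcsin (y / b))
      (Real.continuous_arcsin.comp (continuous_id.div_const b)).continuousOn
      (fun y hy => hasDerivAt_arcsin_div hb0 hy) ?_
    intro y _
    positivity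
  have hnn : 0 ≤ᵐ[volume.restrict (Ioc (-b) b)] fun y : ℝ => 1 / Real.sqrt (b ^ 2 - y ^ 2) :=
    Eventually.of_forall fun y => by positivity
  rw [Measure.restrict_congr_set (Ioc_ae_eq_Icc (μ := (volume : Measure ℝ))).symm,
    ← ofReal_integral_eq_lintegral_ofReal hint hnn, ← intervalIntegral.integral_of_le (by linarith),
    integral_inv_sqrt_sq_sub_sq hb0]

/-! ### The disc integral `∫_{|y| ≤ ε} dy / √(ε² − |y|²) ≤ 2πε` -/

/-- **The disc integral**: `∫_{y₀² + y₁² ≤ ε²} dy / √(ε² − y₀² − y₁²) ≤ 2 ε π` (Fubini: the sections are the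
arcsine integrals; the value is `2πε`). [folklore] -/
theorem lintegral_disc_inv_sqrt_le {ε : ℝ} (hε : 0 < ε) :
    ∫⁻ y : Fin 2 → ℝ, {y : Fin 2 → ℝ | y 0 ^ 2 + y 1 ^ 2 ≤ ε ^ 2}.indicator
        (fun y => ENNReal.ofReal (1 / Real.sqrt (ε ^ 2 - (y 0 ^ 2 + y 1 ^ 2)))) y ≤
      ENNReal.ofReal (2 * ε * Real.pi) := by
  set G : ℝ × ℝ → ℝ≥0∞ := fun p => {p : ℝ × ℝ | p.1 ^ 2 + p.2 ^ 2 ≤ ε ^ 2}.indicator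
    (fun p => ENNReal.ofReal (1 / Real.sqrt (ε ^ 2 - (p.1 ^ 2 + p.2 ^ 2)))) p with hG
  have hGm : Measurable G := by
    refine Measurable.indicator ?_ (measurableSet_le (by fun_prop) measurable_const)
    exact (by fun_prop : Measurable fun p : ℝ × ℝ => 1 / Real.sqrt (ε ^ 2 - (p.1 ^ 2 + p.2 ^ 2))).ennreal_ofReal
  have hcomp : (fun y : Fin 2 → ℝ => {y : Fin 2 → ℝ | y 0 ^ 2 + y 1 ^ 2 ≤ ε ^ 2}.indicator
        (fun y => ENNReal.ofReal (1 / Real.sqrt (ε ^ 2 - (y 0 ^ 2 + y 1 ^ 2)))) y) =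
      fun y => G (MeasurableEquiv.finTwoArrow y) := by
    funext y
    simp only [hG, MeasurableEquiv.finTwoArrow_apply, Set.indicator, mem_setOf_eq]
  rw [hcomp, (volume_preserving_finTwoArrow ℝ).lintegral_comp hGm]
  have hvol : (volume : Measure (ℝ × ℝ)) = (volume : Measure ℝ).prod volume := rfl
  rw [hvol, lintegral_prod _ hGm.aemeasurable]
  have hinner : ∀ x : ℝ, ∫⁻ y, G (x, y) ≤ (Icc (-ε) ε).indicator (fun _ => ENNReal.ofReal Real.pi) x := by
    intro x
    by_cases hx : x ∈ Icc (-ε) ε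
    · rw [indicator_of_mem hx]
      set b := Real.sqrt (ε ^ 2 - x ^ 2) with hb
      have hb0 : 0 ≤ b := Real.sqrt_nonneg _
      have hb2 : b ^ 2 = ε ^ 2 - x ^ 2 := Real.sq_sqrt (by nlinarith [hx.1, hx.2])
      have hsec : (fun y => G (x, y)) =
          (Icc (-b) b).indicator fun y => ENNReal.ofReal (1 / Real.sqrt (b ^ 2 - y ^ 2)) := by
        funext y
        simp only [hG, Set.indicator, mem_setOf_eq, mem_Icc]
        by_cases hxy : x ^ 2 + y ^ 2 ≤ ε ^ 2
        · have hy : -b ≤ y ∧ y ≤ b := abs_le_of_sq_le_sq' (by linarith [hb2]) hb0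
          rw [if_pos hxy, if_pos hy, hb2]
          congr 3
          ring
        · have hy : ¬(-b ≤ y ∧ y ≤ b) := fun h => hxy (by nlinarith [sq_le_sq' h.1 h.2, hb2])
          rw [if_neg hxy, if_neg hy]
      rw [hsec, lintegral_indicator measurableSet_Icc]
      exact lintegral_Icc_inv_sqrt_le hb0
    · rw [indicator_of_notMem hx]
      have hzero : (fun y => G (x, y)) = fun _ => 0 := by
        funext y
        simp only [hG, Set.indicator, mem_setOf_eq]
        rw [if_neg]
        intro hxy
        apply hx
        have h1 : x ^ 2 ≤ ε ^ 2 := by nlinarith [sq_nonneg y]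
        exact abs_le_of_sq_le_sq' h1 hε.le
      rw [hzero, lintegral_zero]
  calc ∫⁻ x, ∫⁻ y, G (x, y) ≤ ∫⁻ x, (Icc (-ε) ε).indicator (fun _ => ENNReal.ofReal Real.pi) x :=
        lintegral_mono hinner
    _ = ENNReal.ofReal Real.pi * volume (Icc (-ε) ε) := lintegral_indicator_const measurableSet_Icc _
    _ = ENNReal.ofReal (2 * ε * Real.pi) := by
        rw [Real.volume_Icc, ← ENNReal.ofReal_mul Real.pi_pos.le]
        congr 1
        ring


end Summit.AtomisticToContinuum.HydrodynamicLimit.Theorems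

end
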